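import Summits.CriticalPhenomena.PercolationContinuityZ3.Theorems.PercNearOneGluingNoHeavyLowerTailCILReduction
import Summits.CriticalPhenomena.PercolationContinuityZ3.Theorems.PercNearOneGluingNoHeavyLowerTailPhiSuperharmonicDefs
import HarnessLib

/-!
# `NoHeavyLowerTail` (stmt-CriticalPhenomena-4575) — Φ-SUPERHARMONICITY implies the cumulative isolation lemma and the crux

Seat `prim-lf-4` (lemma factory #4, LP-duality), 2026-08-19.  With the objects of
`…PhiSuperharmonicDefs` (`Φ_j(w) = max_{a ∈ A} μ_w(|π(a)| ≤ j)`, the vertex-deleted weights `w ∖ C`, the event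
`cluster(u) = C`, and the candidate inequality `PhiSuperharmonic`):

  (Φ-SH)  `μ_w(1 ≤ |π(u)| ≤ j) + Σ_{C ∌ relays, u ∈ C} μ_w(cluster(u) = C) · Φ_j(w ∖ C) ≤ Φ_j(w)`.

The sum is nonnegative and the maximum is attained, so (Φ-SH) gives the cumulative isolation lemma at every level,
hence the crux via the landed `noHeavyLowerTail_of_stub_cumulativeIsolation`:

* `cumulativeIsolation_of_phiSuperharmonic` — (Φ-SH) ⇒ `∀ j, ∃ a ∈ A, μ(1 ≤ N ≤ j) ≤ μ(|π(a)| ≤ j)`;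
* `noHeavyLowerTail_of_phiSuperharmonic` — (Φ-SH) ⇒ `NoHeavyLowerTail` (a CONDITIONAL result: Φ-SH is a candidate,
  evidence in `run/shared/lean/prim/prim-lf-4/PHI-SH.md`).
-/

noncomputable section

namespace Summit.CriticalPhenomena.PercolationContinuityZ3.Theorems

open MeasureTheory Set Literature.Probability.LatticeModels Literature.Probability.Percolation
open Summit.CriticalPhenomena.PercolationContinuityZ3.Theses.PercNearOneGluing
open scoped Classical BigOperators
open PhiSuperharmonic

/-- **(Φ-SH) ⇒ cumulative isolation lemma** (all levels): drop the nonnegative sum and realise the maximum at a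
champion. [this work] -/
theorem cumulativeIsolation_of_phiSuperharmonic (hΦ : PhiSuperharmonic) :
    ∀ (n : ℕ) (w : Sym2 (Fin n) → unitInterval) (A : Finset (Fin n)) (o : Fin n) (j : ℕ),
      A.Nonempty → o ∉ A → ∃ a ∈ A,
        (prodBernoulli w).real {ω : BondConfig (Fin n) |
            1 ≤ (A.filter fun x => ω ∈ openConn o x).card ∧ (A.filter fun x => ω ∈ openConn o x).card ≤ j} ≤
          (prodBernoulli w).real {ω : BondConfig (Fin n) | (A.filter fun x => ω ∈ openConn a x).card ≤ j} := by
  intro n w A o j hA ho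
  have h := hΦ n w A o j hA ho
  have hsum : 0 ≤ ∑ C ∈ (Finset.univ : Finset (Finset (Fin n))).filter (fun C => o ∈ C ∧ Disjoint C A),
      (prodBernoulli w).real (clusterEq o C) * phi (restrictWeights w C) A hA j :=
    Finset.sum_nonneg fun C _ => mul_nonneg measureReal_nonneg (phi_nonneg _ A hA j)
  obtain ⟨a, ha, hmax⟩ := exists_eq_phi w A hA j
  refine ⟨a, ha, ?_⟩
  have hle : (prodBernoulli w).real {ω : BondConfig (Fin n) |
      1 ≤ (A.filter fun x => ω ∈ openConn o x).card ∧ (A.filter fun x => ω ∈ openConn o x).card ≤ j} ≤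
      phi w A hA j := by linarith
  rw [hmax] at hle
  exact hle

/-- **(Φ-SH) ⇒ the crux `NoHeavyLowerTail`**, through the landed reduction
`noHeavyLowerTail_of_stub_cumulativeIsolation`. [this work] -/
theorem noHeavyLowerTail_of_phiSuperharmonic (hΦ : PhiSuperharmonic) :
    Summit.CriticalPhenomena.PercolationContinuityZ3.Theses.PercNearOneGluing.NoHeavyLowerTail :=
  noHeavyLowerTail_of_stub_cumulativeIsolation (cumulativeIsolation_of_phiSuperharmonic hΦ)

end Summit.CriticalPhenomena.PercolationContinuityZ3.Theorems

end
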